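import Mathlib
import Summits.NavierStokesRegularity.NavierStokesRegularity.Theorems.TypeIQuarterGateScarEnvelopeTypeIZoomDictionaryDefs
import Summits.NavierStokesRegularity.NavierStokesRegularity.Theorems.TypeIQuarterGateScarEnvelopeTypeIFatKill
import Summits.NavierStokesRegularity.NavierStokesRegularity.Theorems.TypeIQuarterGateScarEnvelopeTypeIBudgetViolators
import Summits.NavierStokesRegularity.NavierStokesRegularity.Theorems.TypeIQuarterGateScarEnvelopeTypeIOfNoTwinScarObject
import Summits.NavierStokesRegularity.NavierStokesRegularity.Theorems.TypeIQuarterGateQuarterLawTypeIGlue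
import Summits.NavierStokesRegularity.NavierStokesRegularity.Theorems.TypeIQuarterGateEnvelopeQuarterLaw
import Summits.NavierStokesRegularity.NavierStokesRegularity.Theorems.TypeIQuarterGateScarEnvelopeTypeINearOneRateDss
import Literature.Analysis.FluidPDE.AncientAxisymmetricTypeILiouville
import Summits.NavierStokesRegularity.NavierStokesRegularity.Theorems.TypeIQuarterGateScarEnvelopeTypeISatelliteTowerDefs
import Summits.NavierStokesRegularity.NavierStokesRegularity.Theorems.TypeIQuarterGateScarEnvelopeTypeISatelliteTowerObjects
import Summits.NavierStokesRegularity.NavierStokesRegularity.Theorems.TypeIQuarterGateScarEnvelopeTypeISatelliteTowerClosure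
import Summits.NavierStokesRegularity.NavierStokesRegularity.Theorems.TypeIQuarterGateScarEnvelopeTypeISatelliteTowerRooted
import Summits.NavierStokesRegularity.NavierStokesRegularity.Theorems.TypeIQuarterGateScarEnvelopeTypeISatelliteTowerCensus
import Summits.NavierStokesRegularity.NavierStokesRegularity.Theorems.TypeIQuarterGateScarEnvelopeTypeISatelliteTowerExclusions
import Summits.NavierStokesRegularity.NavierStokesRegularity.Theorems.TypeIQuarterGateScarEnvelopeTypeISatelliteTowerEnvelopeDefs
import Summits.NavierStokesRegularity.NavierStokesRegularity.Theorems.TypeIQuarterGateScarEnvelopeTypeISatelliteTowerEnvelopeTame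
import Summits.NavierStokesRegularity.NavierStokesRegularity.Theorems.TypeIQuarterGateScarEnvelopeTypeISatelliteTowerEnvelopeLeaves
import Summits.NavierStokesRegularity.NavierStokesRegularity.Theorems.TypeIQuarterGateScarEnvelopeTypeISatelliteTowerRootRateDefs
import Summits.NavierStokesRegularity.NavierStokesRegularity.Theorems.TypeIQuarterGateScarEnvelopeTypeISatelliteTowerRootMeter

/-!
# Part M4–M7: TAME ⇒ ISOLATED, the ROOT CENSUS, ★★ the second factorisation `(L′) ↔ (E1⁺) ∧ ¬(E2ᵣ)`, the twin-scar enemy's normal form at its root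

Part M4–M7 of the ROUND-33 plate: a tame point is isolated in the final-time singular set (M4); zooming AT THE ROOT with a sphere satellite recorded at every level (`RootObj`/`RootDescends`/`InfiniteRootDescent`, M5); ★★ `typeILiouvilleAB_iff_noEnvelopedLeaf_noRootDescent` (M6); the normal form at the root, S_C′ and the DSS wall on (E2ᵣ) by name (M7).

PROVENANCE: declaration texts VERBATIM from the HOME plates of the instrument seat nsreg-p3 (g24/g25, cell
`pub/ns-regularity-ideate`): `round-31/Tangent31prep.lean` v5 (sha16 `e5b8668e3a090216`; = ROUND-30 plate v10 + Part K) and,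
for Part L, `round-32/Tangent32prep.lean` v6 (sha16 `6123f27718636121`); for Parts M/N, `round-34/Tangent34prep.lean`
v8 (sha16 `84f56c3bc8f4da24`; = v7 `922795f19cd5db01` + Part N);
the author cannot write under `Theorems/` (`perm.theorems-prover-only`); landed by the
LEAD-lineage prover ns-sz-p1 g5 on director-ns DIRECTOR-NS #218 (2), split into ≤ 400-line modules (the
plate's `def`s gathered in `TypeIQuarterGateScarEnvelopeTypeIZoomDictionaryDefs`), namespace
`Summit.NavierStokesRegularity.NavierStokesRegularity.Cruxes.ScarEnvelopeTypeI.ZoomDictionary` (the plate's `NsregP3.R30P`), `E3` spelled out, one-line docstrings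
added where the plate had none.  `--supports stmt-NavierStokesRegularity-23843 --as helper`.

HONEST FRAMING: dictionary / census TOOLING for the crux `TypeIQuarterGate.ScarEnvelopeTypeI` (item 23843):
equivalences and normal forms, kernel-checked; NO open statement is proved — 23843, its parent
`QuarterLawTypeI` (23726), the route and Navier–Stokes regularity are OPEN; hard core evaded: none.
-/

-- the summit-side namespace repeats a component by design (single-conjunct summit, D-0017)
set_option linter.dupNamespace false

open MeasureTheory Set Metric Filter Topology
open scoped ENNReal

namespace Summit.NavierStokesRegularity.NavierStokesRegularity.Cruxes.ScarEnvelopeTypeI.ZoomDictionary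

variable {u : ℝ → (EuclideanSpace ℝ (Fin 3)) → (EuclideanSpace ℝ (Fin 3))} {a : (EuclideanSpace ℝ (Fin 3))} {ν T : ℝ}

section Tower

open Literature.Analysis.FluidPDE
variable {U : ℝ → (EuclideanSpace ℝ (Fin 3)) → (EuclideanSpace ℝ (Fin 3))} {P : ℝ → (EuclideanSpace ℝ (Fin 3)) → ℝ} {y' : (EuclideanSpace ℝ (Fin 3))} {ν : ℝ}
open Summit.NavierStokesRegularity.NavierStokesRegularity.Cruxes.ScarEnvelopeTypeI.ScarZoom
  (CruxHypotheses ScarViolators TwinScarObject singularAt_of_isBackwardSingularPoint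
    exists_localEnergy_of_typeIBound) in

/-- **TAME ⇒ ISOLATED.**  At a tame final-time point of a tower object, the field ITSELF is
essentially bounded near every other final-time point of a punctured neighbourhood: a tame point is
an isolated point of the final-time singular set (or a regular point). -/
theorem TowerObj.isolated_of_budgetAt {M : ℝ} (h : TowerObj M U P) {y' : (EuclideanSpace ℝ (Fin 3))}
    (hb : BudgetAt 1 0 U y') :
    ∃ η : ℝ, 0 < η ∧ ∀ y : (EuclideanSpace ℝ (Fin 3)), y ≠ y' → ‖y - y'‖ < η → RegPt U y := by
  obtain ⟨A, δ, hδ, henv⟩ := h.envelope_of_budgetAt hb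
  exact ⟨δ / 2, by positivity, fun y hy0 hyδ => regPt_of_localEnvelope hδ henv hy0 hyδ⟩

/-- **ACCUMULATION ⇒ SPHERE FILLING.**  If final-time singular points of an A–B object ACCUMULATE at
`y'`, then `y'` is non-tame, so every sphere `‖z‖ = κ⁻¹`, `κ > 1`, carries a satellite of some
tangent flow at `(0, y')`. -/
theorem ABTower.sphere_of_accumulation {M : ℝ} {H : ℝ → (EuclideanSpace ℝ (Fin 3)) → (EuclideanSpace ℝ (Fin 3)) →L[ℝ] (EuclideanSpace ℝ (Fin 3))} (h : ABTower M U P H)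
    {y' : (EuclideanSpace ℝ (Fin 3))} (hacc : ∀ η : ℝ, 0 < η → ∃ y : (EuclideanSpace ℝ (Fin 3)), y ≠ y' ∧ ‖y - y'‖ < η ∧ ¬ RegPt U y)
    {κ : ℝ} (hκ : 1 < κ) :
    ∃ (L : ℕ → ℝ) (Ū : ℝ → (EuclideanSpace ℝ (Fin 3)) → (EuclideanSpace ℝ (Fin 3))), TangentU U P y' 0 L Ū ∧
      ∃ z : (EuclideanSpace ℝ (Fin 3)), ‖z‖ = κ⁻¹ ∧ ¬ RegPt Ū z := by
  refine h.sphere_of_not_budgetAt (fun hb => ?_) hκ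
  obtain ⟨η, hη, hreg⟩ := (towerObj_of_abTower h).isolated_of_budgetAt hb
  obtain ⟨y, hy0, hyη, hy⟩ := hacc η hη
  exact hy (hreg y hy0 hyη)

/-! #### M5. THE ROOT CENSUS: zooming AT THE ROOT, a sphere satellite recorded at every level -/

/-- **The root-census step**: a root object is tame at its root or root-descends to a root object
(M3 at `κ = 4` + K8 `abTower_closed` + L8 persistence at the root). -/
theorem rootObj_step (M : ℝ) :
    ∀ n : TNode, RootObj M n → TameRoot n ∨ ∃ n' : TNode, RootObj M n' ∧ RootDescends n n' := by
  rintro ⟨U, P, H, y⟩ ⟨hAB, h0⟩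
  by_cases hb : BudgetAt 1 0 U 0
  · exact Or.inl hb
  right
  have h4 : (1 : ℝ) < 4 := by norm_num
  obtain ⟨L, Ū, hŪ, z, hz, hreg⟩ := hAB.sphere_of_not_budgetAt hb h4
  obtain ⟨hz0, hz1⟩ := sphere_aux h4 hz
  obtain ⟨U', P', H', hAB', hae⟩ := abTower_closed hAB hŪ
  have h0' : ¬ RegPt U' 0 := fun hr => (towerObj_of_abTower hAB).not_regPt_tangentU_zero h0 hŪ
    ((regPt_iff_of_ae_eq_of_norm_lt_one hae (by simp)).2 hr)
  have hz' : ¬ RegPt U' z := fun hr => hreg ((regPt_iff_of_ae_eq_of_norm_lt_one hae hz1).2 hr)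
  have hz4 : ‖z‖ = 1 / 4 := by rw [hz]; norm_num
  exact ⟨⟨U', P', H', z⟩, ⟨hAB', h0'⟩, L, Ū, hŪ, hae, hz4, hz0, hz'⟩

/-- **THE ROOT CENSUS.**  From every root object: EITHER a finite root-descent chain of root objects
ending at a TAME root, OR an infinite root descent of NON-tame roots. -/
theorem root_census {M : ℝ} {n₀ : TNode} (h₀ : RootObj M n₀) :
    (∃ (c : ℕ → TNode) (k : ℕ), c 0 = n₀ ∧ (∀ i < k, RootDescends (c i) (c (i + 1))) ∧
        (∀ i ≤ k, RootObj M (c i)) ∧ TameRoot (c k)) ∨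
      ∃ c : ℕ → TNode, c 0 = n₀ ∧ ∀ k, RootObj M (c k) ∧ ¬ TameRoot (c k) ∧
        RootDescends (c k) (c (k + 1)) :=
  chain_dichotomy (RootObj M) TameRoot RootDescends (rootObj_step M) h₀

/-- **A TAME SINGULAR ROOT PRODUCES AN ENVELOPED LEAF of the same rate** among its tangent flows at
the root (L3 envelope + K12 existence of tangent flows + L8 persistence + L4 global envelope). -/
theorem envelopedLeaf_of_tameRoot {M : ℝ} {H : ℝ → (EuclideanSpace ℝ (Fin 3)) → (EuclideanSpace ℝ (Fin 3)) →L[ℝ] (EuclideanSpace ℝ (Fin 3))} (h : ABTower M U P H)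
    (h0 : ¬ RegPt U 0) (hb : BudgetAt 1 0 U 0) : ∃ A : ℝ, EnvelopedLeaf M A := by
  have hT : TowerObj M U P := towerObj_of_abTower h
  obtain ⟨A, δ, hδ, henv⟩ := hT.envelope_of_budgetAt hb
  obtain ⟨L, Ū, hŪ⟩ := exists_tangentU_of_towerObj hT 0
  have hŪ0 : ¬ RegPt Ū 0 := hT.not_regPt_tangentU_zero h0 hŪ
  obtain ⟨U', P', H', hAB', hdec, hae⟩ := abTower_closed_decay h hŪ hδ henv
  exact ⟨A, U', P', H', hAB', hdec,
    fun hr => hŪ0 ((regPt_iff_of_ae_eq_of_norm_lt_one hae (by simp)).2 hr)⟩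

/-- ★ **THE ROOT DICHOTOMY.**  Every A–B object singular at the final-time origin yields EITHER an
ENVELOPED LEAF of the same rate (KNSS-envelope class, singular exactly at the origin; reached after
finitely many root descents) OR an INFINITE ROOT DESCENT (E2ᵣ).  Neither branch is excluded here. -/
theorem envelopedLeaf_or_infiniteRootDescent {M : ℝ} {H : ℝ → (EuclideanSpace ℝ (Fin 3)) → (EuclideanSpace ℝ (Fin 3)) →L[ℝ] (EuclideanSpace ℝ (Fin 3))}
    (h : ABTower M U P H) (h0 : ¬ RegPt U 0) :
    (∃ A : ℝ, EnvelopedLeaf M A) ∨ InfiniteRootDescent M := by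
  rcases root_census (n₀ := ⟨U, P, H, 0⟩) ⟨h, h0⟩ with ⟨c, k, -, -, hch, htame⟩ | ⟨c, -, hc⟩
  · exact Or.inl (envelopedLeaf_of_tameRoot (hch k le_rfl).1 (hch k le_rfl).2 htame)
  · exact Or.inr ⟨c, hc⟩

/-! #### M6. ★★ THE SECOND FACTORISATION of (L′): `(L′) ↔ (E1⁺) ∧ ¬(E2ᵣ)` -/

/-- ★★ **(L′) ⟺ (E1⁺) ∧ «NO INFINITE ROOT DESCENT».**  Read next to ROUND-32's
`typeILiouvilleAB_iff : (L′) ↔ (no rooted node) ∧ (E1⁺)`: modulo the KNSS-envelope Liouville (E1⁺),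
the residuals «no rooted node» (⟸ S_C′, sufficient for 23843) and «no infinite root descent» (E2ᵣ)
COINCIDE. -/
theorem typeILiouvilleAB_iff_rootForm :
    TypeILiouvilleAB ↔ (∀ M A : ℝ, ¬ EnvelopedLeaf M A) ∧ ∀ M : ℝ, ¬ InfiniteRootDescent M := by
  refine ⟨fun h => ⟨fun M A hE => ?_, fun M hI => ?_⟩, fun hh M U P H hAB => ?_⟩
  · obtain ⟨U, P, H, hAB, -, h0⟩ := hE
    exact h0 (h M U P H hAB)
  · obtain ⟨c, hc⟩ := hI
    exact (hc 0).1.2 (h M _ _ _ (hc 0).1.1)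
  · by_contra h0
    rcases envelopedLeaf_or_infiniteRootDescent hAB h0 with ⟨A, hA⟩ | hI
    · exact hh.1 M A hA
    · exact hh.2 M hI

/-- The two residuals coincide modulo (E1⁺). -/
theorem noRooted_iff_noRootDescent_of_noEnvelopedLeaf (hE : ∀ M A : ℝ, ¬ EnvelopedLeaf M A) :
    (∀ (M : ℝ) (n : TNode), ¬ RootedNode M n) ↔ ∀ M : ℝ, ¬ InfiniteRootDescent M := by
  constructor
  · intro hno
    exact (typeILiouvilleAB_iff_rootForm.1 (typeILiouvilleAB_iff.2 ⟨hno, hE⟩)).2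
  · intro hI
    exact (typeILiouvilleAB_iff.1 (typeILiouvilleAB_iff_rootForm.2 ⟨hE, hI⟩)).1

/-! #### M7. The twin-scar enemy's NORMAL FORM AT ITS ROOT; S_C′ and the DSS wall on (E2ᵣ) BY NAME -/

/-- Every level `k + 1` of an infinite root descent is a ROOTED NODE (an A–B object singular at the
origin with a satellite — on the sphere `‖y‖ = 1/4`), hence a twin-scar object of the same rate after
K11's normalisation. -/
theorem infiniteRootDescent_rootedNode {M : ℝ} {c : ℕ → TNode}
    (hc : ∀ k, RootObj M (c k) ∧ ¬ TameRoot (c k) ∧ RootDescends (c k) (c (k + 1))) (k : ℕ) :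
    RootedNode M (c (k + 1)) ∧ ‖(c (k + 1)).y‖ = 1 / 4 := by
  obtain ⟨-, -, -, -, hnorm, hmem⟩ := (hc k).2.2
  exact ⟨⟨⟨(hc (k + 1)).1.1, hmem⟩, (hc (k + 1)).1.2⟩, hnorm⟩

/-- «No rooted node» (⟸ S_C′) kills (E2ᵣ). -/
theorem not_infiniteRootDescent_of_noRooted (hno : ∀ (M : ℝ) (n : TNode), ¬ RootedNode M n)
    (M : ℝ) : ¬ InfiniteRootDescent M := fun ⟨_, hc⟩ =>
  hno M _ (infiniteRootDescent_rootedNode hc 0).1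

open Summit.NavierStokesRegularity.NavierStokesRegularity.Cruxes.ScarEnvelopeTypeI in
/-- scar_zoom's deciding stub «no twin-scar object of any rate» kills (E2ᵣ) BY NAME. -/
theorem not_infiniteRootDescent_of_noTwinScar
    (h : ∀ (M : ℝ) (v : ℝ → (EuclideanSpace ℝ (Fin 3)) → (EuclideanSpace ℝ (Fin 3))), ¬ ScarZoom.TwinScarObject M v) (M : ℝ) :
    ¬ InfiniteRootDescent M :=
  not_infiniteRootDescent_of_noRooted (noRooted_of_noTwinScar h) M

/-- **The DSS wall on (E2ᵣ)** (informational, tree `nearOneRateDss_proof` via K11): no level of an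
infinite root descent is `d`-DSS about any centre for `1 < d < c₁(M)`. -/
theorem infiniteRootDescent_not_nearOneDss {M : ℝ} {c : ℕ → TNode}
    (hc : ∀ k, RootObj M (c k) ∧ ¬ TameRoot (c k) ∧ RootDescends (c k) (c (k + 1))) :
    ∃ c₁ : ℝ, 1 < c₁ ∧ ∀ k, ∀ d : ℝ, 1 < d → d < c₁ → ∀ x₀ : (EuclideanSpace ℝ (Fin 3)),
      ¬ IsDiscretelySelfSimilar d (fun t x => (c k).U t (x + x₀)) := by
  obtain ⟨c₁, hc₁, h⟩ := abTower_not_nearOneDss M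
  exact ⟨c₁, hc₁, fun k d h1 h2 x₀ => h d h1 h2 (c k).U (c k).P (c k).H (hc k).1.1 (hc k).1.2 x₀⟩

/-- An enveloped-root twin scar is a rooted node; its satellites keep a distance from the root. -/
theorem EnvelopedRootTwinScar.rootedNode {M : ℝ} (h : EnvelopedRootTwinScar M) :
    ∃ n : TNode, RootedNode M n ∧ TameRoot n ∧
      ∃ η : ℝ, 0 < η ∧ ∀ y ∈ satellites n.U, η ≤ ‖y‖ := by
  obtain ⟨U, P, H, hAB, h0, henv, y, hy⟩ := h
  have hb : BudgetAt 1 0 U 0 := (hAB.budgetAt_iff_enveloped 0).2 henv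
  obtain ⟨η, hη, hreg⟩ := (towerObj_of_abTower hAB).isolated_of_budgetAt hb
  refine ⟨⟨U, P, H, y⟩, ⟨⟨hAB, hy⟩, h0⟩, hb, η, hη, fun y₁ hy₁ => ?_⟩
  by_contra hlt
  push Not at hlt
  exact hy₁.2 (hreg y₁ hy₁.1 (by simpa using hlt))

/-- ★ **NORMAL FORM OF THE TWIN-SCAR ENEMY AT ITS ROOT.**  A rooted node of rate `M` yields EITHER an
enveloped-root twin scar of rate `M` (the root census stops at a tame level: level `0` keeps the
node's own satellite, a level `k ≥ 1` the sphere satellite handed down) OR an infinite root descent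
of rate `M`. -/
theorem rootForm_of_rootedNode {M : ℝ} {n : TNode} (hn : RootedNode M n) :
    EnvelopedRootTwinScar M ∨ InfiniteRootDescent M := by
  rcases root_census (n₀ := n) ⟨hn.1.1, hn.2⟩ with ⟨c, k, hc0, hdesc, hch, htame⟩ | ⟨c, -, hc⟩
  · left
    have hsat : (c k).y ∈ satellites (c k).U := by
      rcases Nat.eq_zero_or_pos k with hk | hk
      · subst hk
        rw [hc0]
        exact hn.1.2
      · have hd := hdesc (k - 1) (by omega)
        rw [Nat.sub_add_cancel hk] at hd
        obtain ⟨-, -, -, -, -, hmem⟩ := hd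
        exact hmem
    obtain ⟨hAB, h0⟩ := hch k le_rfl
    exact ⟨_, _, _, hAB, h0, (hAB.budgetAt_iff_enveloped 0).1 htame, _, hsat⟩
  · exact Or.inr ⟨c, hc⟩

open Summit.NavierStokesRegularity.NavierStokesRegularity.Cruxes.ScarEnvelopeTypeI in
/-- **If the crux item 23843 fails**: for some rate `M` there is an enveloped-root twin scar or an
infinite root descent (K9 rooting + the root census).  OPEN: neither is excluded; 23843, S_C′, 23726,
N0 remain open. -/
theorem rootForm_of_not_scarEnvelopeTypeI
    (h : ¬ Summit.NavierStokesRegularity.NavierStokesRegularity.Theses.TypeIQuarterGate.ScarEnvelopeTypeI) :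
    ∃ M : ℝ, EnvelopedRootTwinScar M ∨ InfiniteRootDescent M := by
  obtain ⟨M, U, P, H, e, hAB, -, h0, he, -⟩ := exists_abTower_of_not_scarEnvelopeTypeI h
  exact ⟨M, rootForm_of_rootedNode (n := ⟨U, P, H, e⟩) ⟨⟨hAB, he⟩, h0⟩⟩

/-- Both branches of the root form are rooted nodes: «no rooted node» excludes them, and so does
scar_zoom's «no twin-scar object» (`noRooted_of_noTwinScar`). -/
theorem noRootForm_of_noRooted (hno : ∀ (M : ℝ) (n : TNode), ¬ RootedNode M n) (M : ℝ) :
    ¬ EnvelopedRootTwinScar M ∧ ¬ InfiniteRootDescent M :=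
  ⟨fun hE => by
    obtain ⟨n, hn, -⟩ := hE.rootedNode
    exact hno M n hn,
    not_infiniteRootDescent_of_noRooted hno M⟩

/-- **The scoreboard at the root** (record): «no rooted node» ⟺ «no enveloped-root twin scar ∧ no
infinite root descent» for every rate — the root form loses nothing. -/
theorem noRooted_iff_noRootForm :
    (∀ (M : ℝ) (n : TNode), ¬ RootedNode M n) ↔
      ∀ M : ℝ, ¬ EnvelopedRootTwinScar M ∧ ¬ InfiniteRootDescent M := by
  refine ⟨fun hno M => noRootForm_of_noRooted hno M, fun h M n hn => ?_⟩
  rcases rootForm_of_rootedNode hn with hE | hI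
  · exact (h M).1 hE
  · exact (h M).2 hI

end Tower

end Summit.NavierStokesRegularity.NavierStokesRegularity.Cruxes.ScarEnvelopeTypeI.ZoomDictionary
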